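import Summits.QuantumFields.YangMills.Theses.FradkinShenkerFlow
import Literature.MathematicalPhysics.QuantumFieldTheory.LatticeGaugeProofs
import Literature.MathematicalPhysics.StatisticalMechanics.HardCoreCanonical
import Literature.Probability.LatticeModels.TorusCentredLift

/-!
# `FiniteSusceptibilityWeakCoupling` — negative-side support: the susceptibility clause at `β = 0`

Support file for crux `stmt-QuantumFields-9442` (`FradkinShenkerFlow.FiniteSusceptibilityWeakCoupling`),
extracted from the standing disprover's work file `Cruxes/FiniteSusceptibilityWeakCoupling/Disproof.lean` §3.
The crux asks, for compact simple `G` and faithful `r`, for `β₀` with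
`sup_S ∑_{x ∈ box 4 S} |Cov_{β,2S+1}(A∘lift, B∘τ_x∘lift)| < ∞` for all `β ≥ β₀` and all local gauge-invariant
`A, B`.  Here the inner clause is written out verbatim and PROVED at `β = 0`, for EVERY compact group and every
representation, with the explicit constant `4·|supp A|·|supp B|·a·b` (`a, b` sup bounds of `A, B`):

* `wilsonMeasure_zero` — at `β = 0` the torus Wilson measure is product Haar (`Z = 1`);
* `abs_covariance_le_of_abs_le` — `|Cov(X,Y)| ≤ 4ab` for `|X| ≤ a`, `|Y| ≤ b` under a probability measure;
* `dependsOn_comp_torusLift`, `dependsOn_comp_configShift_torusLift` — the pulled-back observables are cylinder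
  functions of the torus edges below (the translate of) their supports;
* `card_filter_torusEdge_eq_le_one` — in the fundamental domain `box 4 S` of the torus of side `2S+1` at most one
  translate moves a given edge onto a given torus edge;
* `sum_abs_cov_le_at_beta_zero`, `susceptibility_clause_at_beta_zero` — the bound and the clause.

Boundary information for provers and adversaries alike: every potential counterexample to the crux lives at
`β > 0`, and the gauge group enters the clause only through the `β`-dependence of the Wilson weight. [folklore]
-/

noncomputable section

open MeasureTheory ProbabilityTheory Finset
open Literature.MathematicalPhysics.QuantumFieldTheory hiding ZdEdge
open Literature.MathematicalPhysics.QuantumLattice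
open Literature.Probability.LatticeModels hiding configShift configShift_apply

namespace Summit.QuantumFields.YangMills.Theorems.FiniteSusceptibilityWeakCoupling.Negative

variable {G : Type} [Group G] [TopologicalSpace G] [IsTopologicalGroup G] [CompactSpace G]
  [MeasurableSpace G] [BorelSpace G] {N : ℕ} (ρ : G →* Matrix (Fin N) (Fin N) ℂ)

/-- At `β = 0` the torus Wilson measure is the product of Haar probability measures (`Z = 1`). [folklore] -/
theorem wilsonMeasure_zero {d L : ℕ} [NeZero L] :
    wilsonMeasure (d := d) (L := L) ρ 0 = Measure.pi fun _ : Edge d L => haarProbability G := by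
  have hw : wilsonWeight (d := d) (L := L) ρ 0 = Measure.pi fun _ : Edge d L => haarProbability G := by
    simp [wilsonWeight]
  have hZ : partitionFunction (d := d) (L := L) ρ 0 = 1 := by
    simp [partitionFunction, hw]
  simp [wilsonMeasure, hZ, hw]

omit [Group G] [TopologicalSpace G] [IsTopologicalGroup G] [CompactSpace G] [MeasurableSpace G]
  [BorelSpace G] in
/-- Covariances of bounded functions under a probability measure: `|Cov(X,Y)| ≤ 4ab`. [folklore] -/
theorem abs_covariance_le_of_abs_le {Ω : Type*} [MeasurableSpace Ω] {μ : Measure Ω}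
    [IsProbabilityMeasure μ] {X Y : Ω → ℝ} {a b : ℝ} (hX : ∀ ω, |X ω| ≤ a) (hY : ∀ ω, |Y ω| ≤ b) :
    |cov[X, Y; μ]| ≤ 4 * a * b := by
  obtain ⟨ω₀⟩ := nonempty_of_isProbabilityMeasure μ
  have ha : 0 ≤ a := (abs_nonneg _).trans (hX ω₀)
  have hb : 0 ≤ b := (abs_nonneg _).trans (hY ω₀)
  have hEX : |μ[X]| ≤ a := by
    have := norm_integral_le_of_norm_le_const (μ := μ) (f := X) (C := a)
      (Filter.Eventually.of_forall fun ω => by simpa [Real.norm_eq_abs] using hX ω)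
    simpa [Real.norm_eq_abs] using this
  have hEY : |μ[Y]| ≤ b := by
    have := norm_integral_le_of_norm_le_const (μ := μ) (f := Y) (C := b)
      (Filter.Eventually.of_forall fun ω => by simpa [Real.norm_eq_abs] using hY ω)
    simpa [Real.norm_eq_abs] using this
  have hpt : ∀ ω, |(X ω - μ[X]) * (Y ω - μ[Y])| ≤ 4 * a * b := fun ω => by
    rw [abs_mul]
    have h1 : |X ω - μ[X]| ≤ 2 * a := (abs_sub _ _).trans (by linarith [hX ω])
    have h2 : |Y ω - μ[Y]| ≤ 2 * b := (abs_sub _ _).trans (by linarith [hY ω])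
    calc |X ω - μ[X]| * |Y ω - μ[Y]| ≤ (2 * a) * (2 * b) :=
          mul_le_mul h1 h2 (abs_nonneg _) (by linarith)
      _ = 4 * a * b := by ring
  have := norm_integral_le_of_norm_le_const (μ := μ)
    (f := fun ω => (X ω - μ[X]) * (Y ω - μ[Y])) (C := 4 * a * b)
    (Filter.Eventually.of_forall fun ω => by simpa [Real.norm_eq_abs] using hpt ω)
  simpa [covariance, Real.norm_eq_abs] using this

variable (L : ℕ) [NeZero L]

omit [TopologicalSpace G] [IsTopologicalGroup G] [CompactSpace G] [BorelSpace G] [NeZero L] in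
/-- An observable of `ℤ⁴` pulled back by the periodic lift depends only on the torus edges below its support.
[folklore] -/
theorem dependsOn_comp_torusLift (A : YMSpecies G) :
    DependsOn (fun U : GaugeConfig 4 L G => A.F (torusLift L U)) ↑(A.supp.image (torusEdge L)) := by
  intro U V h
  apply A.isCylinder
  intro e he
  show U (torusEdge L e) = V (torusEdge L e)
  exact h _ (Finset.mem_coe.2 (Finset.mem_image_of_mem _ (Finset.mem_coe.1 he)))

omit [TopologicalSpace G] [IsTopologicalGroup G] [CompactSpace G] [BorelSpace G] [NeZero L] in
/-- The translate by `x` of an observable, pulled back by the periodic lift, depends only on the torus edges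
below the translated support. [folklore] -/
theorem dependsOn_comp_configShift_torusLift (B : YMSpecies G) (x : Site 4) :
    DependsOn (fun U : GaugeConfig 4 L G => B.F (configShift (-x) (torusLift L U)))
      ↑(B.supp.image fun e => torusEdge L (e.1 + x, e.2)) := by
  intro U V h
  apply B.isCylinder
  intro e he
  rw [Literature.MathematicalPhysics.QuantumLattice.configShift_apply,
    Literature.MathematicalPhysics.QuantumLattice.configShift_apply, sub_neg_eq_add]
  exact h (torusEdge L (e.1 + x, e.2)) (by
    rw [Finset.mem_coe, Finset.mem_image]
    exact ⟨e, Finset.mem_coe.1 he, rfl⟩)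

omit [NeZero L] in
/-- In the fundamental domain `box 4 S` of the torus of side `L = 2S+1`, at most one translate `x` moves a given
edge `e'` onto a given torus edge. [folklore] -/
theorem card_filter_torusEdge_eq_le_one (S : ℕ) (hL : L = 2 * S + 1) (e e' : ZdEdge 4) :
    ((box 4 S).filter fun x => torusEdge L e = torusEdge L (e'.1 + x, e'.2)).card ≤ 1 := by
  refine Finset.card_le_one.2 fun x hx y hy => ?_
  rw [Finset.mem_filter] at hx hy
  have hxy : Torus.proj L (e'.1 + x) = Torus.proj L (e'.1 + y) := by
    have := hx.2.symm.trans hy.2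
    exact congrArg Prod.fst this
  have habs : ∀ j, |(e'.1 + x) j - (e'.1 + y) j| < L := fun j => by
    have hxj := (mem_box.1 hx.1) j
    have hyj := (mem_box.1 hy.1) j
    simp only [Pi.add_apply, add_sub_add_left_eq_sub]
    rw [hL]; push_cast
    rw [abs_lt]; constructor <;> linarith [hxj.1, hxj.2, hyj.1, hyj.2]
  have := Torus.proj_injective_of_abs_sub_lt habs hxy
  exact add_left_cancel this

/-- **The bound at `β = 0`, explicit constant.** Under product Haar measure the covariance of `A∘lift` and
`B∘τ_x∘lift` vanishes unless the torus images of `supp A` and of `supp B + x` meet, which happens for at most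
`|supp A|·|supp B|` translates `x ∈ box 4 S`; each term is at most `4ab`. [folklore] -/
theorem sum_abs_cov_le_at_beta_zero (A B : YMSpecies G) {a b : ℝ} (ha : ∀ U, |A.F U| ≤ a)
    (hb : ∀ U, |B.F U| ≤ b) (S : ℕ) :
    ∑ x ∈ box 4 S, |cov[fun U => A.F (torusLift (2 * S + 1) U),
      fun U => B.F (configShift (-x) (torusLift (2 * S + 1) U));
      wilsonMeasure (d := 4) (L := 2 * S + 1) ρ 0]| ≤ (A.supp.card * B.supp.card : ℕ) * (4 * a * b) := by
  classical
  set L := 2 * S + 1 with hL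
  rw [wilsonMeasure_zero]
  set μ : Measure (GaugeConfig 4 L G) := Measure.pi fun _ : Edge 4 L => haarProbability G with hμ
  -- the translates whose shifted support meets the support of `A` on the torus
  set bad : Finset (Site 4) := (box 4 S).filter fun x =>
    ¬ Disjoint (A.supp.image (torusEdge L)) (B.supp.image fun e => torusEdge L (e.1 + x, e.2)) with hbad
  have hzero : ∀ x ∈ box 4 S, x ∉ bad →
      |cov[fun U => A.F (torusLift L U), fun U => B.F (configShift (-x) (torusLift L U)); μ]| = 0 := by
    intro x hx hxb
    have hdisj : Disjoint (A.supp.image (torusEdge L)) (B.supp.image fun e => torusEdge L (e.1 + x, e.2)) := by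
      by_contra hnd
      exact hxb (Finset.mem_filter.2 ⟨hx, hnd⟩)
    have hFm : Measurable fun U : GaugeConfig 4 L G => A.F (torusLift L U) :=
      A.measurable.comp (measurable_torusLift L)
    have hGm : Measurable fun U : GaugeConfig 4 L G => B.F (configShift (-x) (torusLift L U)) :=
      B.measurable.comp ((configShift (-x)).measurable.comp (measurable_torusLift L))
    have hind : IndepFun (fun U : GaugeConfig 4 L G => A.F (torusLift L U))
        (fun U => B.F (configShift (-x) (torusLift L U))) μ :=
      Literature.MathematicalPhysics.StatisticalMechanics.indepFun_of_dependsOn (haarProbability G) hdisj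
        hFm hGm (dependsOn_comp_torusLift L A) (dependsOn_comp_configShift_torusLift L B x)
    have hXa : MemLp (fun U : GaugeConfig 4 L G => A.F (torusLift L U)) 2 μ :=
      MemLp.of_bound hFm.aestronglyMeasurable a (Filter.Eventually.of_forall fun U => by
        simpa [Real.norm_eq_abs] using ha _)
    have hYb : MemLp (fun U : GaugeConfig 4 L G => B.F (configShift (-x) (torusLift L U))) 2 μ :=
      MemLp.of_bound hGm.aestronglyMeasurable b (Filter.Eventually.of_forall fun U => by
        simpa [Real.norm_eq_abs] using hb _)
    rw [hind.covariance_eq_zero hXa hYb, abs_zero]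
  have hsum : ∑ x ∈ box 4 S, |cov[fun U => A.F (torusLift L U),
      fun U => B.F (configShift (-x) (torusLift L U)); μ]| =
      ∑ x ∈ bad, |cov[fun U => A.F (torusLift L U), fun U => B.F (configShift (-x) (torusLift L U)); μ]| :=
    (Finset.sum_subset (Finset.filter_subset _ _) hzero).symm
  have hcard : bad.card ≤ A.supp.card * B.supp.card := by
    have hsub : bad ⊆ (A.supp ×ˢ B.supp).biUnion fun p =>
        (box 4 S).filter fun x => torusEdge L p.1 = torusEdge L (p.2.1 + x, p.2.2) := by
      intro x hx
      rw [hbad, Finset.mem_filter, Finset.not_disjoint_iff] at hx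
      obtain ⟨hxbox, t, htA, htB⟩ := hx
      obtain ⟨e, he, rfl⟩ := Finset.mem_image.1 htA
      obtain ⟨e', he', hee'⟩ := Finset.mem_image.1 htB
      refine Finset.mem_biUnion.2 ⟨(e, e'), Finset.mem_product.2 ⟨he, he'⟩, ?_⟩
      exact Finset.mem_filter.2 ⟨hxbox, hee'.symm⟩
    calc bad.card ≤ ((A.supp ×ˢ B.supp).biUnion fun p =>
          (box 4 S).filter fun x => torusEdge L p.1 = torusEdge L (p.2.1 + x, p.2.2)).card :=
          Finset.card_le_card hsub
      _ ≤ ∑ p ∈ A.supp ×ˢ B.supp,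
          ((box 4 S).filter fun x => torusEdge L p.1 = torusEdge L (p.2.1 + x, p.2.2)).card :=
          Finset.card_biUnion_le
      _ ≤ ∑ _p ∈ A.supp ×ˢ B.supp, 1 :=
          Finset.sum_le_sum fun p _ => card_filter_torusEdge_eq_le_one L S hL p.1 p.2
      _ = A.supp.card * B.supp.card := by simp
  have hab : 0 ≤ 4 * a * b := by
    obtain ⟨U₀⟩ : Nonempty (LGConfig 4 G) := ⟨fun _ => 1⟩
    have ha0 : 0 ≤ a := (abs_nonneg _).trans (ha U₀)
    have hb0 : 0 ≤ b := (abs_nonneg _).trans (hb U₀)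
    positivity
  calc ∑ x ∈ box 4 S, |cov[fun U => A.F (torusLift L U),
          fun U => B.F (configShift (-x) (torusLift L U)); μ]|
        = ∑ x ∈ bad, |cov[fun U => A.F (torusLift L U),
            fun U => B.F (configShift (-x) (torusLift L U)); μ]| := hsum
    _ ≤ ∑ _x ∈ bad, 4 * a * b :=
        Finset.sum_le_sum fun x _ => abs_covariance_le_of_abs_le (fun U => ha _) (fun U => hb _)
    _ = bad.card * (4 * a * b) := by simp
    _ ≤ (A.supp.card * B.supp.card : ℕ) * (4 * a * b) :=
        mul_le_mul_of_nonneg_right (by exact_mod_cast hcard) hab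

/-- **The crux's susceptibility clause holds at `β = 0`**, for every compact group `G` (no simplicity, no
connectedness) and every matrix representation `ρ` (no faithfulness, no unitarity): at the strong-coupling end of
the `β`-axis there is no obstruction, whatever the group — every potential counterexample to
`FiniteSusceptibilityWeakCoupling` lives at `β > 0`. [folklore] -/
theorem susceptibility_clause_at_beta_zero (A B : YMSpecies G) :
    ∃ χ : ℝ, ∀ S : ℕ,
      ∑ x ∈ box 4 S, |cov[fun U => A.F (torusLift (2 * S + 1) U),
        fun U => B.F (configShift (-x) (torusLift (2 * S + 1) U));
        wilsonMeasure (d := 4) (L := 2 * S + 1) ρ 0]| ≤ χ := by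
  obtain ⟨a, ha⟩ := A.bounded
  obtain ⟨b, hb⟩ := B.bounded
  exact ⟨(A.supp.card * B.supp.card : ℕ) * (4 * a * b), fun S => sum_abs_cov_le_at_beta_zero ρ A B ha hb S⟩

end Summit.QuantumFields.YangMills.Theorems.FiniteSusceptibilityWeakCoupling.Negative

end
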